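import Literature.Probability.LatticeModels.ImprovedTreeDiagramBoundSum
import Literature.Probability.LatticeModels.SlidingScaleInfraredBoundProofs
import Literature.Probability.LatticeModels.HighDimTrivialityAssemblyProofs
import HarnessLib

/-!
# High-dimensional triviality of Ising scaling limits, IX: crit-ising.S13 (`Sweep1` form) from the correlation-length window bound

Topic `Literature/Probability/LatticeModels`; family `crit-ising` (crit-ising.S13). Theorems only
(no definition, no statement, no named fact is introduced or changed).

`HighDimTrivialityAssemblyProofs` reduces the `Sweep1` statement
`isGaussianProcess_of_tendstoInDistribution_smearedSpin` (Gaussianity of every subsequential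
scaling limit of the nearest-neighbour Ising spin field, `d ≥ 4`, ARBITRARY `β_k ∈ [0, β_c]`,
`δ_k → 0⁺`, bounded second moments) to the single named fact `panis_ursellFourSum_le_four`
(Panis 2023, Cor. 1.8: the `d = 4` bound on `Σ_L⁻² ∑_{Λ_{rL}⁴} |U₄|` in the SHARP-LENGTH window
`L ≤ L(β)`). The sibling statement in the printed regime,
`isGaussianProcess_of_tendstoInDistribution_smearedSpin_printRegime`, rests instead
(`HighDimTrivialityProofs`, `ImprovedTreeDiagramBoundSum`) on the CORRELATION-LENGTH window bound
`aizenmanDuminilCopin_ursellFourSum_le` (Aizenman–Duminil-Copin 2021, §6.3: `d = 4`, `1 < L ≤ ξ(β)`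
or `β = β_c`), which `aizenmanDuminilCopin_ursellFourSum_le_of_facts` derives from the paper's
numbered theorems — Theorem 1.3 (the improved tree diagram bound,
`aizenmanDuminilCopin_improvedTreeDiagramBound`, a named fact) and Theorem 5.6 (the sliding-scale
infrared bound, PROVED: `aizenmanDuminilCopin_slidingScaleInfraredBound_holds`).

**This file puts the `Sweep1` statement on the same footing**: it is derived from
`aizenmanDuminilCopin_ursellFourSum_le` alone (`…_of_adc`), hence from ADC Theorem 1.3 alone
(`…_of_improvedTreeDiagramBound`). What has to be supplied is the uniformity in the temperature
off the window `L ≤ ξ(β)` for `d = 4` (for `d ≥ 5` the statement is the tree's theorem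
`isGaussianProcess_of_tendstoInDistribution_smearedSpin_of_five_le`; the high-temperature regime
`β ≤ β₀` is `ursellFourSum_le_of_le_smallBeta`). The argument, for `β₀ < β < β_c` and
`θ := χ_L(β)/L²` (`χ_L = ∑_{Λ_L} ⟨σ₀σ_x⟩_β`), is a dichotomy in which the correlation length is
never bounded from below without a logarithmic loss — the loss is paid for by the scaling of the
block-spin variance:

* `θ ≤ η` ("the two-point function is much smaller than `L^{2-d}`", ADC 2021, p. 6: "already
  the unadulterated tree diagram bound suffices"): the plain tree diagram bound, the
  sliding-scale infrared bound and the Messager–Miracle-Solé comparison give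
  `Σ_L⁻² ∑_{Λ_{rL}⁴} |U₄| ≤ K D⁶ r¹² θ²` (`ursellFourSum_le_sq_ratio`: the bounds on the sums
  (1)–(4) of ADC §6.3 WITHOUT the improvement factor, `∑_u F⁴ ≤ K₄ D⁴ r¹² L⁴ χ_L⁴`,
  `Σ_L ≥ L⁴χ_L/(256 D)`, `D = C_{5.6}/β₀ ∨ 1`).
* `θ > η`: Theorem 5.6 read downwards gives `χ_ℓ ≥ (η/D) ℓ²` for all `1 ≤ ℓ ≤ L`; the MMS
  average over an annulus and the infrared bound turn this into the pointwise lower bound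
  `⟨σ₀σ_{ne₁}⟩ ≥ g/(162 A² n²)` at `n = ⌊L/A⌋` (`axis_twoPointFn_ge_of_growth`); Griffiths'
  supermultiplicativity along the axis bounds the inverse correlation length,
  `ξ(β)⁻¹ ≤ -log⟨σ₀σ_{ne₁}⟩/n ≤ Q/n`, `Q = 2 log n + log(162A²/g)`
  (`invCorrLength_twoPointPlus_le_axis`), so the scale `L' = n/Q` lies in the window;
  `aizenmanDuminilCopin_ursellFourSum_le` at scale `L'` with radius parameter `r' = rL/L'`
  bounds the same numerator `∑_{Λ_{rL}⁴} |U₄| ≤ C r'¹² (log L')^{-c} Σ_{L'}²`, and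
  `Σ_{L'} ≤ 324 C_χ L'⁶` (infrared bound) against `Σ_L ≥ η L⁶/(256 D)` (the case hypothesis)
  gives `Σ_L⁻² ∑_{Λ_{rL}⁴} |U₄| ≤ C (324·256 C_χ D/η)² (r'L'/L)¹² (log L')^{-c}
  = C' r¹² (log L')^{-c}` — the twelfth powers of the dilation cancel exactly — with
  `L' ≥ √n/(4 + log(162A²/g)) → ∞`.

## Contents

* Part 1. `axis_twoPointFn_ge_of_growth`, `invCorrLength_twoPointPlus_le_axis` (lattice /
  Griffiths lemmas), `blockSpinVariance_le_card_mul_boxSusceptibility` (`Σ_L ≤ |Λ_L| χ_{2L}`).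
* Part 2. `ursellFourSum_le_sq_ratio` (the `θ ≤ η` bound, abstract two-point function).
* Part 3. `ursellFourSum_small_four_of_adc` (the `d = 4` uniform smallness from
  `aizenmanDuminilCopin_ursellFourSum_le`), `ursellFourSum_uniformlySmall_of_adc` (all `d ≥ 4`).
* Part 4. `isGaussianProcess_of_tendstoInDistribution_smearedSpin_of_adc`,
  `isGaussianProcess_of_tendstoInDistribution_smearedSpin_of_improvedTreeDiagramBound` —
  **crit-ising.S13 (`Sweep1` form) from ADC Theorem 1.3 alone**; the discharge `…_holds` is the
  latter applied to `aizenmanDuminilCopin_improvedTreeDiagramBound_holds` once Theorem 1.3 is proved.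

## References

* M. Aizenman, H. Duminil-Copin, Ann. of Math. 194 (2021) = arXiv:1912.07973, Thm 1.2 with
  Def. 1.1, Thm 1.3, Prop. 1.4 (pp. 4–6), Thm 5.6 (p. 18), §6.3 (pp. 26–27), Remark 6.8
  [AizenmanDuminilCopinAnnals2021] (held; read pp. 5–6, 17–21, 26–27).
* R. Panis, arXiv:2309.05797, §1.2.1 fn. 2, §3.6 (Def. 3.21, Prop. 3.23: the lower bound on the
  two-point function below the sharp length, whose MMS mechanism is the one used in Part 1)
  [Panis2023Triviality] (held; read pp. 16–17, 20–22).
* M. Aizenman, Comm. Math. Phys. 86 (1982), §1 [AizenmanCMP1982]; J. Fröhlich, Nucl. Phys. B 200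
  (1982) [FrohlichTrivialityNPB1982].

## Mathlib

`Filter.liminf_le_of_frequently_le`, `Filter.frequently_atTop`, `Real.rpow` algebra
(`Real.rpow_inv_rpow`, `Real.rpow_le_rpow`), `Real.add_one_le_exp`, `Real.log_le_sub_one_of_pos`,
`Nat.floor`; no definitions.
-/

noncomputable section

open MeasureTheory ProbabilityTheory Filter Topology Finset
open scoped NNReal
open Literature.Probability.LatticeModels Literature.Probability.Percolation

namespace Literature.Probability.LatticeModels

/-! ### Part 1. Lattice and Griffiths lemmas -/

section Lattice

variable {S : Site 4 → ℝ}

/-- **From quadratic growth of the truncated susceptibility to a pointwise lower bound on the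
axis** (the Messager–Miracle-Solé averaging mechanism of Panis 2023, Prop. 3.23 / ADC 2021,
(5.3)): if `S ≥ 0` satisfies the MMS comparison `S(z) ≤ S(w)` for `4‖w‖_∞ ≤ ‖z‖_∞`,
`χ_{An} ≥ g (An)²` and `χ_{4n} ≤ C_x (4n)²` with `32 C_x ≤ g A²` (`A ≥ 4`, `n ≥ 1`), then
`S(n e₁) ≥ g/(162 A² n²)`: the sites `z ∈ Λ_{An}` with `‖z‖_∞ ≥ 4n` carry at least
`g A²n² - 16 C_x n² ≥ g A² n²/2` of the susceptibility, each is dominated by `S(n e₁)`, and there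
are at most `|Λ_{An}| ≤ 81 A⁴ n⁴` of them. [cite: Panis2023Triviality, Prop. 3.23 and its proof (p. 16)] [cite: AizenmanDuminilCopinAnnals2021, arXiv:1912.07973 §5.1 eq. (5.3)] -/
theorem axis_twoPointFn_ge_of_growth (hS0 : ∀ v, 0 ≤ S v)
    (hMMS : ∀ z w : Site 4, 4 * Site.supNorm w ≤ Site.supNorm z → S z ≤ S w)
    {n A : ℕ} (hn : 1 ≤ n) (hA : 4 ≤ A) {g Cx : ℝ}
    (hbig : g * ((A : ℝ) * n) ^ 2 ≤ boxSusceptibility S ((A : ℝ) * n))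
    (hsmall : boxSusceptibility S ((4 : ℝ) * n) ≤ Cx * ((4 : ℝ) * n) ^ 2)
    (hAg : 32 * Cx ≤ g * (A : ℝ) ^ 2) :
    g / (162 * (A : ℝ) ^ 2 * (n : ℝ) ^ 2) ≤ S (Pi.single 0 (n : ℤ)) := by
  classical
  set B : Finset (Site 4) := box 4 (A * n) with hB
  set B' : Finset (Site 4) := box 4 (4 * n - 1) with hB'
  have hB'B : B' ⊆ B := box_mono 4 (by
    have : 4 * n ≤ A * n := Nat.mul_le_mul_right n hA
    omega)
  have hn0 : (0 : ℝ) < n := by exact_mod_cast hn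
  have hA0 : (0 : ℝ) < A := by exact_mod_cast (show 0 < A by omega)
  -- the two box sums
  have hBeq : boxSusceptibility S ((A : ℝ) * n) = ∑ z ∈ B, S z := by
    rw [show ((A : ℝ) * n) = ((A * n : ℕ) : ℝ) by push_cast; ring, boxSusceptibility_natCast]
  have hB'le : ∑ z ∈ B', S z ≤ Cx * ((4 : ℝ) * n) ^ 2 := by
    have h1 : ∑ z ∈ B', S z ≤ ∑ z ∈ box 4 (4 * n), S z :=
      Finset.sum_le_sum_of_subset_of_nonneg (box_mono 4 (by omega)) fun v _ _ => hS0 v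
    have h2 : boxSusceptibility S ((4 : ℝ) * n) = ∑ z ∈ box 4 (4 * n), S z := by
      rw [show ((4 : ℝ) * n) = ((4 * n : ℕ) : ℝ) by push_cast; ring, boxSusceptibility_natCast]
    linarith
  -- the annular sum from below
  have hann_ge : g * (A : ℝ) ^ 2 / 2 * (n : ℝ) ^ 2 ≤ ∑ z ∈ B \ B', S z := by
    rw [Finset.sum_sdiff_eq_sub hB'B, ← hBeq]
    have h16 : Cx * ((4 : ℝ) * n) ^ 2 = 16 * Cx * (n : ℝ) ^ 2 := by ring
    have hCx : 16 * Cx * (n : ℝ) ^ 2 ≤ g * (A : ℝ) ^ 2 / 2 * (n : ℝ) ^ 2 := by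
      have : 16 * Cx ≤ g * (A : ℝ) ^ 2 / 2 := by linarith
      exact mul_le_mul_of_nonneg_right this (sq_nonneg _)
    have hbig' : g * (A : ℝ) ^ 2 * (n : ℝ) ^ 2 ≤ boxSusceptibility S ((A : ℝ) * n) := by
      calc g * (A : ℝ) ^ 2 * (n : ℝ) ^ 2 = g * ((A : ℝ) * n) ^ 2 := by ring
        _ ≤ _ := hbig
    linarith
  -- the annular sum from above: every site is dominated by `S (n e₁)`
  have hsn : Site.supNorm (Pi.single 0 (n : ℤ) : Site 4) = n := by
    rw [Site.supNorm_single]; simp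
  have hann_le : ∑ z ∈ B \ B', S z ≤ 81 * (A : ℝ) ^ 4 * (n : ℝ) ^ 4 * S (Pi.single 0 (n : ℤ)) := by
    have hpt : ∀ z ∈ B \ B', S z ≤ S (Pi.single 0 (n : ℤ)) := by
      intro z hz
      obtain ⟨-, hzB'⟩ := Finset.mem_sdiff.1 hz
      refine hMMS z _ ?_
      rw [hsn]
      have : ¬ Site.supNorm z ≤ 4 * n - 1 := fun h => hzB' (mem_box_iff_supNorm_le.2 h)
      omega
    have hcard : (#(B \ B') : ℝ) ≤ 81 * (A : ℝ) ^ 4 * (n : ℝ) ^ 4 := by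
      calc (#(B \ B') : ℝ) ≤ #B := by exact_mod_cast Finset.card_le_card Finset.sdiff_subset
        _ = (2 * ((A : ℝ) * n) + 1) ^ 4 := by rw [hB, card_box]; push_cast; ring
        _ ≤ (3 * ((A : ℝ) * n)) ^ 4 := by
            apply pow_le_pow_left₀ (by positivity)
            have : (1 : ℝ) ≤ (A : ℝ) * n := one_le_mul_of_one_le_of_one_le
              (by exact_mod_cast (show 1 ≤ A by omega)) (by exact_mod_cast hn)
            linarith
        _ = 81 * (A : ℝ) ^ 4 * (n : ℝ) ^ 4 := by ring
    have hS0n : 0 ≤ S (Pi.single 0 (n : ℤ)) := hS0 _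
    calc ∑ z ∈ B \ B', S z ≤ ∑ _z ∈ B \ B', S (Pi.single 0 (n : ℤ)) := Finset.sum_le_sum hpt
      _ = #(B \ B') * S (Pi.single 0 (n : ℤ)) := by rw [Finset.sum_const, nsmul_eq_mul]
      _ ≤ 81 * (A : ℝ) ^ 4 * (n : ℝ) ^ 4 * S (Pi.single 0 (n : ℤ)) :=
          mul_le_mul_of_nonneg_right hcard hS0n
  -- conclusion
  have hkey : g * (A : ℝ) ^ 2 / 2 * (n : ℝ) ^ 2 ≤
      81 * (A : ℝ) ^ 4 * (n : ℝ) ^ 4 * S (Pi.single 0 (n : ℤ)) := hann_ge.trans hann_le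
  rw [div_le_iff₀ (by positivity)]
  have h81 : 0 < 81 * (A : ℝ) ^ 4 * (n : ℝ) ^ 4 := by positivity
  nlinarith [hkey, h81, sq_nonneg ((A : ℝ) * n)]

/-- **The inverse correlation length is controlled by any one value on the axis** (Griffiths'
second inequality in the form `⟨σ₀σ_x⟩⁺⟨σ₀σ_{y-x}⟩⁺ ≤ ⟨σ₀σ_y⟩⁺`, `twoPointPlus_mul_le_twoPointPlus`,
iterated: `⟨σ₀σ_{kne₁}⟩⁺ ≥ ⟨σ₀σ_{ne₁}⟩⁺ᵏ`, so that along the subsequence `m = kn` the defining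
`liminf` of `ξ⁻¹ = liminf_m -log⟨σ₀σ_{me₁}⟩⁺/m` is at most `-log⟨σ₀σ_{ne₁}⟩⁺/n`; Friedli–Velenik
2017, §3.10.7 / Simon 1993, §II.12: subadditivity of `-log⟨σ₀σ_{me₁}⟩`). For `β ≥ 0`, `n ≥ 1`
with `⟨σ₀σ_{ne₁}⟩⁺_β > 0`: `ξ(β)⁻¹ ≤ -log⟨σ₀σ_{ne₁}⟩⁺_β / n`. [cite: FriedliVelenik2017, §3.10.7 (correlation length; subadditivity)] -/
theorem invCorrLength_twoPointPlus_le_axis {d : ℕ} [NeZero d] {β : ℝ} (hβ : 0 ≤ β) {n : ℕ}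
    (hn : 1 ≤ n) (hpos : 0 < twoPointPlus d β (Pi.single 0 (n : ℤ))) :
    invCorrLength (twoPointPlus d β) ≤ -Real.log (twoPointPlus d β (Pi.single 0 (n : ℤ))) / n := by
  have hG0 : ∀ z, 0 ≤ twoPointPlus d β z := twoPointPlus_nonneg_of_gks hβ
  have hG1 : ∀ z, twoPointPlus d β z ≤ 1 := twoPointPlus_le_one_of_nonneg hβ
  have hn0 : (0 : ℝ) < n := by exact_mod_cast hn
  -- supermultiplicativity along the axis
  have hpow : ∀ k : ℕ, twoPointPlus d β (Pi.single 0 (n : ℤ)) ^ k ≤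
      twoPointPlus d β (Pi.single 0 ((k * n : ℕ) : ℤ)) := by
    intro k
    induction k with
    | zero => simp [twoPointPlus_zero]
    | succ k ih =>
      have h := twoPointPlus_mul_le_twoPointPlus hβ (Pi.single 0 ((k * n : ℕ) : ℤ) : Site d)
        (Pi.single 0 (((k + 1) * n : ℕ) : ℤ))
      have hsub : (Pi.single 0 (((k + 1) * n : ℕ) : ℤ) : Site d) - Pi.single 0 ((k * n : ℕ) : ℤ) =
          Pi.single 0 (n : ℤ) := by
        rw [← Pi.single_sub]
        congr 1
        push_cast
        ring
      rw [hsub] at h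
      calc twoPointPlus d β (Pi.single 0 (n : ℤ)) ^ (k + 1)
          = twoPointPlus d β (Pi.single 0 (n : ℤ)) ^ k * twoPointPlus d β (Pi.single 0 (n : ℤ)) :=
            pow_succ _ _
        _ ≤ twoPointPlus d β (Pi.single 0 ((k * n : ℕ) : ℤ)) * twoPointPlus d β (Pi.single 0 (n : ℤ)) :=
            mul_le_mul_of_nonneg_right ih (hG0 _)
        _ ≤ twoPointPlus d β (Pi.single 0 (((k + 1) * n : ℕ) : ℤ)) := h
  -- the defining sequence
  have hsm : ∀ m : ℕ, ((m : ℤ) • Pi.single (0 : Fin d) (1 : ℤ) : Site d) = Pi.single 0 (m : ℤ) := by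
    intro m
    ext i
    by_cases hi : i = 0
    · subst hi; simp
    · simp [hi]
  unfold invCorrLength
  set u : ℕ → ℝ := fun m : ℕ =>
    -Real.log |twoPointPlus d β ((m : ℤ) • Pi.single (0 : Fin d) (1 : ℤ))| / m with hu
  have hu0 : ∀ m, 0 ≤ u m := by
    intro m
    rw [hu]
    refine div_nonneg ?_ (Nat.cast_nonneg m)
    rw [neg_nonneg]
    refine Real.log_nonpos (abs_nonneg _) ?_
    rw [abs_le]
    exact ⟨by linarith [hG0 ((m : ℤ) • Pi.single (0 : Fin d) (1 : ℤ))], hG1 _⟩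
  have hval : ∀ N : ℕ, u ((N + 1) * n) ≤ -Real.log (twoPointPlus d β (Pi.single 0 (n : ℤ))) / n := by
    intro N
    rw [hu]
    dsimp only
    have hKn : (0 : ℝ) < (((N + 1) * n : ℕ) : ℝ) := by positivity
    have hle : twoPointPlus d β (Pi.single 0 (n : ℤ)) ^ (N + 1) ≤
        twoPointPlus d β (Pi.single 0 (((N + 1) * n : ℕ) : ℤ)) := hpow (N + 1)
    have hlog : Real.log (twoPointPlus d β (Pi.single 0 (n : ℤ)) ^ (N + 1)) ≤
        Real.log (twoPointPlus d β (Pi.single 0 (((N + 1) * n : ℕ) : ℤ))) :=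
      Real.log_le_log (pow_pos hpos _) hle
    rw [Real.log_pow] at hlog
    rw [hsm, abs_of_nonneg (hG0 _), div_le_div_iff₀ hKn hn0]
    push_cast at hlog ⊢
    nlinarith [hlog, hn0]
  exact liminf_le_of_frequently_le
    (frequently_atTop.2 fun N => ⟨(N + 1) * n, by nlinarith [hn], hval N⟩)
    ⟨0, Filter.eventually_map.2 (Eventually.of_forall hu0)⟩

/-- **`Σ_L ≤ |Λ_L| χ_{2L}`**: the block-spin variance `Σ_L = ∑_{x,y ∈ Λ_L} S(y - x)` is at
most `|Λ_L|` times the truncated susceptibility at scale `2L` (`y - x ∈ Λ_{2L}`, `S ≥ 0`). [folklore] -/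
theorem blockSpinVariance_le_card_mul_boxSusceptibility (μ : Measure (SpinConfig (Site 4)))
    [IsFiniteMeasure μ] (hS : ∀ x y, ∫ σ, spinAt x σ * spinAt y σ ∂μ = S (y - x))
    (hS0 : ∀ v, 0 ≤ S v) (L : ℝ) :
    blockSpinVariance μ L ≤ #(latticeBox 4 L) * boxSusceptibility S (L + L) := by
  rw [blockSpinVariance_eq_sum_sum]
  simp_rw [hS]
  calc ∑ x ∈ latticeBox 4 L, ∑ y ∈ latticeBox 4 L, S (y - x)
      ≤ ∑ _x ∈ latticeBox 4 L, boxSusceptibility S (L + L) :=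
        Finset.sum_le_sum fun x hx => shiftSum_le_boxSusceptibility hS0 hx
    _ = #(latticeBox 4 L) * boxSusceptibility S (L + L) := by rw [Finset.sum_const, nsmul_eq_mul]

end Lattice

/-! ### Part 2. Off the window: the plain tree diagram bound with the sliding-scale infrared bound -/

section OffWindow

variable {S : Site 4 → ℝ}

set_option maxHeartbeats 4000000 in
/-- **The bound on `Σ_L⁻² ∑_{Λ_{rL}⁴} |U₄|` by the square of `χ_L/L²`** (Aizenman–Duminil-Copin
2021, §6.3, the bounds on the sums (1)–(4) with the plain tree diagram bound in place of
Theorem 1.3, and p. 6: "In the second case … already the unadulterated tree diagram bound (1.11)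
suffices"). Let `μ` be a state on `ℤ⁴` with two-point function `S ≥ 0`, `S(0) = 1`, satisfying
the Messager–Miracle-Solé comparison, the sliding-scale infrared bound with constant `D`
(`χ_{L'}/L'² ≤ D χ_ℓ/ℓ²`, `1 ≤ ℓ ≤ L'`), the tree diagram bound `|U₄(x)| ≤ 2 ∑_u ∏ S(xᵢ - u)` and
`∑ S⁴ < ∞`. Then for `L ≥ 4`, `r ≥ 1`:
`Σ_L⁻² ∑_{x ∈ Λ_{rL}⁴} |U₄(x)| ≤ K D⁶ r¹² (χ_L/L²)²`, `K = 2 · 256² · (48⁴289⁴ + 54·81⁴·4096)`: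
`∑_u F(u)⁴ ≤ K₄ D⁴ r¹² L⁴ χ_L⁴` (`summable_tsum_shiftSum_pow_four_le`, `twoPointFn_le_of_mms_sliding`)
and `Σ_L ≥ L⁴ χ_L/(256 D)` (`pow_four_mul_boxSusceptibility_le_blockSpinVariance`). [cite: AizenmanDuminilCopinAnnals2021, arXiv:1912.07973 §6.3, bounds on (1)–(4) (pp. 26–27) and p. 6] -/
theorem ursellFourSum_le_sq_ratio {μ : Measure (SpinConfig (Site 4))} [IsProbabilityMeasure μ]
    (hS : ∀ x y, ∫ σ, spinAt x σ * spinAt y σ ∂μ = S (y - x))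
    (hS0 : ∀ v, 0 ≤ S v) (hSz : S 0 = 1)
    (hMMS : ∀ z w : Site 4, 4 * Site.supNorm w ≤ Site.supNorm z → S z ≤ S w)
    {D : ℝ} (hD : 0 < D)
    (h56 : ∀ ℓ L' : ℝ, 1 ≤ ℓ → ℓ ≤ L' →
      boxSusceptibility S L' / L' ^ 2 ≤ D * (boxSusceptibility S ℓ / ℓ ^ 2))
    (h4 : Summable fun v => S v ^ 4)
    (hTB : ∀ x : Fin 4 → Site 4, |connectedFour μ spinAt x| ≤ 2 * ∑' u, ∏ i, S (x i - u))
    {L r : ℝ} (hL : 4 ≤ L) (hr : 1 ≤ r) :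
    ursellFourSum μ L r ≤ (2 * 256 ^ 2 * (48 ^ 4 * 289 ^ 4 + 54 * 81 ^ 4 * 4096)) * D ^ 6 *
      r ^ 12 * (boxSusceptibility S L / L ^ 2) ^ 2 := by
  set K₄ : ℝ := 48 ^ 4 * 289 ^ 4 + 54 * 81 ^ 4 * 4096 with hK₄_def
  have hL1 : 1 ≤ L := by linarith
  have hL0 : 0 < L := by linarith
  have hLne : L ≠ 0 := hL0.ne'
  have hr0 : 0 < r := by linarith
  have hsumx := summable_prod_shift hS0 h4
  -- the box `Λ_{rL}`
  set t : ℝ := r * L with ht_def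
  have ht1 : 1 ≤ t := by nlinarith
  have ht0 : 0 < t := by linarith
  have hχL0 : 0 ≤ boxSusceptibility S L := boxSusceptibility_nonneg hS0 _
  have hχL1 : 1 ≤ boxSusceptibility S L := by
    rw [boxSusceptibility]
    calc (1 : ℝ) = S 0 := hSz.symm
      _ ≤ _ := Finset.single_le_sum (f := S) (fun v _ => hS0 v) (zero_mem_latticeBox hL0.le)
  have hχLpos : 0 < boxSusceptibility S L := by linarith
  set A : ℝ := 16 * D * boxSusceptibility S L / L ^ 2 with hA_def
  have hA0' : 0 ≤ A := by positivity
  have hSA : ∀ v : Site 4, 16 * t / 2 ≤ (Site.supNorm v : ℝ) →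
      S v ≤ A / (Site.supNorm v : ℝ) ^ 2 := by
    intro v hv
    exact twoPointFn_le_of_mms_sliding hS0 hMMS hD.le h56 hL1 (v := v) (by nlinarith)
  obtain ⟨-, hW4⟩ := summable_tsum_shiftSum_pow_four_le hS0 ht1 (R := 16 * t) (by linarith) hA0' hSA
  have hχ17 : boxSusceptibility S (t + 16 * t) ≤ 289 * D * boxSusceptibility S L * r ^ 2 := by
    have h := h56 L (17 * t) hL1 (by nlinarith)
    rw [div_le_iff₀ (by positivity)] at h
    rw [show t + 16 * t = 17 * t by ring]
    refine h.trans (le_of_eq ?_)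
    rw [ht_def]
    field_simp
    ring
  have hχ17_0 : 0 ≤ boxSusceptibility S (t + 16 * t) := boxSusceptibility_nonneg hS0 _
  have hcard16 : (#(latticeBox 4 (16 * t)) : ℝ) ≤ (3 * (16 * t)) ^ 4 := card_latticeBox_le (by linarith)
  have hcardt : (#(latticeBox 4 t) : ℝ) ≤ (3 * t) ^ 4 := card_latticeBox_le ht1
  have hfl16 : 8 * t ≤ (⌊16 * t⌋₊ : ℝ) := by
    have := Nat.lt_floor_add_one (16 * t); linarith
  have hW4' : ∑' u, (∑ a ∈ latticeBox 4 t, S (a - u)) ^ 4 ≤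
      K₄ * D ^ 4 * r ^ 12 * L ^ 4 * boxSusceptibility S L ^ 4 := by
    calc ∑' u, (∑ a ∈ latticeBox 4 t, S (a - u)) ^ 4
        ≤ #(latticeBox 4 (16 * t)) * boxSusceptibility S (t + 16 * t) ^ 4 +
            54 * ((#(latticeBox 4 t) : ℝ) * (4 * A)) ^ 4 / (⌊16 * t⌋₊ : ℝ) ^ 4 := hW4
      _ ≤ (3 * (16 * t)) ^ 4 * (289 * D * boxSusceptibility S L * r ^ 2) ^ 4 +
            54 * ((3 * t) ^ 4 * (4 * A)) ^ 4 / (8 * t) ^ 4 := by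
          gcongr
      _ = K₄ * D ^ 4 * r ^ 12 * L ^ 4 * boxSusceptibility S L ^ 4 := by
          rw [hK₄_def, hA_def, ht_def]
          field_simp
          ring
  -- the numerator
  have hS' : ∀ x y, ∫ σ, spinAt x σ * spinAt y σ ∂μ = S (x - y) := by
    intro x y
    rw [← hS y x]
    exact integral_congr_ae (ae_of_all _ fun σ => mul_comm _ _)
  have hnum : ∑ x ∈ Fintype.piFinset (fun _ : Fin 4 => latticeBox 4 (r * L)),
      |connectedFour μ spinAt x| ≤ 2 * (K₄ * D ^ 4 * r ^ 12 * L ^ 4 * boxSusceptibility S L ^ 4) := by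
    calc ∑ x ∈ Fintype.piFinset (fun _ : Fin 4 => latticeBox 4 (r * L)), |connectedFour μ spinAt x|
        ≤ ∑ x ∈ Fintype.piFinset (fun _ : Fin 4 => latticeBox 4 t), 2 * ∑' u, ∏ i, S (x i - u) :=
          Finset.sum_le_sum fun x _ => hTB x
      _ = 2 * ∑' u, (∑ a ∈ latticeBox 4 t, S (a - u)) ^ 4 := by
          rw [← Finset.mul_sum, sum_piFinset_tsum_prod_eq _ hsumx]
      _ ≤ 2 * (K₄ * D ^ 4 * r ^ 12 * L ^ 4 * boxSusceptibility S L ^ 4) := by gcongr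
  -- the denominator
  have hden := pow_four_mul_boxSusceptibility_le_blockSpinVariance μ hS hS0 hD.le h56 hL
  have hY0 : 0 < L ^ 4 * boxSusceptibility S L / (256 * D) := by positivity
  have hYle : L ^ 4 * boxSusceptibility S L / (256 * D) ≤ blockSpinVariance μ L := by
    rw [div_le_iff₀ (by positivity)]
    linarith
  have hSig0 : 0 < blockSpinVariance μ L := hY0.trans_le hYle
  -- conclusion
  rw [ursellFourSum, div_le_iff₀ (pow_pos hSig0 2)]
  calc ∑ x ∈ Fintype.piFinset (fun _ : Fin 4 => latticeBox 4 (r * L)), |connectedFour μ spinAt x|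
      ≤ 2 * (K₄ * D ^ 4 * r ^ 12 * L ^ 4 * boxSusceptibility S L ^ 4) := hnum
    _ = (2 * 256 ^ 2 * K₄) * D ^ 6 * r ^ 12 * (boxSusceptibility S L / L ^ 2) ^ 2 *
          (L ^ 4 * boxSusceptibility S L / (256 * D)) ^ 2 := by
        field_simp
    _ ≤ (2 * 256 ^ 2 * K₄) * D ^ 6 * r ^ 12 * (boxSusceptibility S L / L ^ 2) ^ 2 *
          blockSpinVariance μ L ^ 2 := by
        gcongr
    _ = (2 * 256 ^ 2 * (48 ^ 4 * 289 ^ 4 + 54 * 81 ^ 4 * 4096)) * D ^ 6 * r ^ 12 *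
          (boxSusceptibility S L / L ^ 2) ^ 2 * blockSpinVariance μ L ^ 2 := by
        rw [hK₄_def]

end OffWindow

/-- **Transfer of a bound at the window scale `L'` to the scale `L`.** If the numerator
`∑_{x ∈ Λ_{rL}⁴} |U₄(x)|` is at most `M Σ_{L'}²` (the content of a bound on `S(μ; L', rL/L')`),
`χ_t ≤ C_χ t²` for `t ≥ 1` (infrared bound), `χ_L ≥ η L²` and `L⁴ χ_L ≤ 256 D Σ_L` (sliding-scale
infrared bound), then, as `Σ_{L'} ≤ |Λ_{L'}| χ_{2L'} ≤ 324 C_χ L'⁶` and `Σ_L ≥ η L⁶/(256 D)`,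
`S(μ; L, r) ≤ M (324 C_χ)² (256 D)² L'¹² / (η² L¹²)`. [cite: AizenmanDuminilCopinAnnals2021, arXiv:1912.07973 §6.3, "χ_L(β) ≤ C₅L⁻⁴Σ_L(β)" (p. 26)] -/
theorem ursellFourSum_le_of_window_transfer {S : Site 4 → ℝ} {μ : Measure (SpinConfig (Site 4))}
    [IsProbabilityMeasure μ] (hS : ∀ x y, ∫ σ, spinAt x σ * spinAt y σ ∂μ = S (y - x))
    (hS0 : ∀ v, 0 ≤ S v) {Cχ : ℝ}
    (hχS : ∀ t : ℝ, 1 ≤ t → boxSusceptibility S t ≤ Cχ * t ^ 2)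
    {D η L L' r M : ℝ} (hD : 0 < D) (hη : 0 < η) (hL : 1 ≤ L) (hL' : 1 ≤ L') (hM : 0 ≤ M)
    (hnum : ∑ x ∈ Fintype.piFinset (fun _ : Fin 4 => latticeBox 4 (r * L)),
        |connectedFour μ spinAt x| ≤ M * blockSpinVariance μ L' ^ 2)
    (hχL : η * L ^ 2 ≤ boxSusceptibility S L)
    (hden : L ^ 4 * boxSusceptibility S L ≤ 256 * D * blockSpinVariance μ L) :
    ursellFourSum μ L r ≤ M * (324 * Cχ) ^ 2 * (256 * D) ^ 2 * L' ^ 12 / (η ^ 2 * L ^ 12) := by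
  have hL0 : 0 < L := by linarith
  have hL'0 : 0 < L' := by linarith
  have hG : ∀ x y, 0 ≤ ∫ σ, spinAt x σ * spinAt y σ ∂μ := fun x y => by rw [hS]; exact hS0 _
  have hSig'0 : 0 ≤ blockSpinVariance μ L' :=
    zero_le_one.trans (one_le_blockSpinVariance μ hG hL'0.le)
  -- `Σ_{L'} ≤ 324 C_χ L'⁶`
  have hSig'le : blockSpinVariance μ L' ≤ 324 * Cχ * L' ^ 6 := by
    have h1 := blockSpinVariance_le_card_mul_boxSusceptibility μ hS hS0 L'
    have hcard : (#(latticeBox 4 L') : ℝ) ≤ (3 * L') ^ 4 := card_latticeBox_le hL'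
    have hχ2 : boxSusceptibility S (L' + L') ≤ Cχ * (L' + L') ^ 2 := hχS _ (by linarith)
    calc blockSpinVariance μ L' ≤ #(latticeBox 4 L') * boxSusceptibility S (L' + L') := h1
      _ ≤ (3 * L') ^ 4 * (Cχ * (L' + L') ^ 2) :=
          mul_le_mul hcard hχ2 (boxSusceptibility_nonneg hS0 _) (by positivity)
      _ = 324 * Cχ * L' ^ 6 := by ring
  -- `Σ_L ≥ η L⁶/(256 D)`
  have hSigL : η * L ^ 6 / (256 * D) ≤ blockSpinVariance μ L := by
    rw [div_le_iff₀ (by positivity)]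
    calc η * L ^ 6 = L ^ 4 * (η * L ^ 2) := by ring
      _ ≤ L ^ 4 * boxSusceptibility S L := by gcongr
      _ ≤ 256 * D * blockSpinVariance μ L := hden
      _ = blockSpinVariance μ L * (256 * D) := by ring
  have hY0 : 0 < η * L ^ 6 / (256 * D) := by positivity
  have hSigLpos : 0 < blockSpinVariance μ L := hY0.trans_le hSigL
  rw [ursellFourSum, div_le_iff₀ (pow_pos hSigLpos 2)]
  calc ∑ x ∈ Fintype.piFinset (fun _ : Fin 4 => latticeBox 4 (r * L)), |connectedFour μ spinAt x|
      ≤ M * blockSpinVariance μ L' ^ 2 := hnum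
    _ ≤ M * (324 * Cχ * L' ^ 6) ^ 2 := by gcongr
    _ = M * (324 * Cχ) ^ 2 * (256 * D) ^ 2 * L' ^ 12 / (η ^ 2 * L ^ 12) *
          (η * L ^ 6 / (256 * D)) ^ 2 := by
        field_simp
    _ ≤ M * (324 * Cχ) ^ 2 * (256 * D) ^ 2 * L' ^ 12 / (η ^ 2 * L ^ 12) *
          blockSpinVariance μ L ^ 2 := by
        gcongr

/-! ### Part 3. Uniform smallness of `S(μ; L, r)` from the correlation-length window bound -/

section Synthesis

set_option maxHeartbeats 4000000 in
/-- **Uniform smallness of `Σ_L⁻² ∑_{Λ_{rL}⁴} |U₄|` in `d = 4`, for all `β ≤ β_c`, from the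
correlation-length window bound of Aizenman–Duminil-Copin 2021, §6.3**
(`aizenmanDuminilCopin_ursellFourSum_le`: `≤ C r¹² (log L)^{-c}` for `1 < L ≤ ξ(β)` or
`β = β_c`): for every `r ≥ 1` and `ε > 0` there is `L₀` with `S(μ; L, r) ≤ ε` for all `L ≥ L₀`,
all `0 ≤ β ≤ β_c(4)` and all `μ ∈ 𝒢(β, 0)`. The four regimes (module docstring): `β ≤ β₀`
(`ursellFourSum_le_of_le_smallBeta`); `β = β_c` (the fact at scale `L`); and for `β₀ < β < β_c`
the dichotomy on `θ = χ_L/L²` — `θ ≤ η` by `ursellFourSum_le_sq_ratio` (plain tree diagram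
bound, sliding-scale infrared bound `aizenmanDuminilCopin_slidingScaleInfraredBound_holds`, MMS),
`θ > η` by the fact at the window scale `L' = n/Q` (`axis_twoPointFn_ge_of_growth`,
`invCorrLength_twoPointPlus_le_axis`) transferred to `L` (`ursellFourSum_le_of_window_transfer`).
A derived statement: no source prints the uniformity in `β` (ADC 2021, Def. 1.1 allows the
temperature to vary along the sequence; Panis 2023, §1.2.1 fn. 2 discusses the regimes). [cite: AizenmanDuminilCopinAnnals2021, arXiv:1912.07973 §6.3 (pp. 26–27), Thm 5.6 (p. 18), p. 6 ("already the unadulterated tree diagram bound suffices"), Def. 1.1 (p. 4)] [cite: Panis2023Triviality, §1.2.1 fn. 2 and Prop. 3.23] -/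
theorem ursellFourSum_small_four_of_adc (hS₄ : aizenmanDuminilCopin_ursellFourSum_le)
    {r : ℝ} (hr : 1 ≤ r) {ε : ℝ} (hε : 0 < ε) :
    ∃ L₀ : ℝ, ∀ (β L : ℝ), 0 ≤ β → β ≤ criticalBeta 4 → L₀ ≤ L →
      ∀ μ ∈ isingGibbsMeasures 4 β 0, ursellFourSum μ L r ≤ ε := by
  classical
  -- ### inputs: theorems of the tree
  have hU₁ : ∀ {d : ℕ} {β : ℝ}, hasUniqueGibbsMeasure_of_lt_criticalBeta (d := d) (β := β) :=
    fun {d} {β} => hasUniqueGibbsMeasure_of_lt_criticalBeta_holds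
  have hU₂ : ∀ {d : ℕ}, hasUniqueGibbsMeasure_criticalBeta (d := d) :=
    fun {d} => hasUniqueGibbsMeasure_criticalBeta_holds
  have hF : ∀ (d : ℕ) {β : ℝ}, exists_freeMeasure d (β := β) 0 := fun d => exists_freeMeasure_holds d 0
  obtain ⟨c₄, C₄, hc₄, hC₄, H4⟩ := hS₄
  obtain ⟨C₃, hC₃, H56⟩ := aizenmanDuminilCopin_slidingScaleInfraredBound_holds (d := 4) (by norm_num)
  obtain ⟨C₀, hC₀⟩ := twoPointFree_criticalBeta_upper_holds (d := 4) (by norm_num)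
  obtain ⟨Cχ, hCχ0, hCχ⟩ := exists_sum_box_twoPointFree_le_sq
  obtain ⟨β₀, hβ₀, hφ₀⟩ := exists_beta_dctIsingPhi_singleton_lt (d := 4)
  have hTBdlr := treeDiagramBound_dlr_of_treeDiagramBound
    Literature.Barriers.CriticalPhenomena.treeDiagramBound_holds hU₁ hU₂ hF (d := 4) (by norm_num)
  have hlim : hasBoxLimit_isingCorr_free 4 := hasBoxLimit_isingCorr_free_holds
  have hgks : ∀ {Λ A : Finset (Site 4)} {β h : ℝ} {bc : BoundaryCondition (Site 4)},
      gks_one (zdGraph 4) (Λ := Λ) (A := A) (β := β) (h := h) (bc := bc) :=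
    GKSInequalities.gks_one_holds (zdGraph 4)
  have hβmono : isingCorr_free_mono_beta (d := 4) := isingCorr_free_mono_beta_of_gks_two
    fun _ _ _ _ _ _ => GKSInequalities.gks_two_holds (zdGraph 4)
  -- ### constants
  set A₀ : ℝ := max C₀ 1 with hA₀_def
  have hA₀ : 0 ≤ A₀ := le_trans zero_le_one (le_max_right _ _)
  set Cχ' : ℝ := 4 * Cχ with hCχ'_def
  have hCχ'pos : 0 < Cχ' := by positivity
  set D : ℝ := max (C₃ / β₀) 1 with hD_def
  have hD1 : 1 ≤ D := le_max_right _ _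
  have hDpos : 0 < D := one_pos.trans_le hD1
  set K : ℝ := 2 * 256 ^ 2 * (48 ^ 4 * 289 ^ 4 + 54 * 81 ^ 4 * 4096) with hK_def
  have hKpos : 0 < K := by rw [hK_def]; norm_num
  set KA : ℝ := K * D ^ 6 * r ^ 12 with hKA_def
  have hKApos : 0 < KA := by positivity
  -- the threshold `η` of the dichotomy
  set η : ℝ := min 1 (ε / (KA + 1)) with hη_def
  have hη1 : η ≤ 1 := min_le_left _ _
  have hηpos : 0 < η := lt_min one_pos (div_pos hε (by positivity))
  have hηε : KA * η ≤ ε := by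
    have h1 : η ≤ ε / (KA + 1) := min_le_right _ _
    rw [le_div_iff₀ (by positivity)] at h1
    have : KA * η ≤ η * (KA + 1) := by linarith [hηpos.le]
    linarith
  -- the growth constant `g = η/D` and the annulus parameter `A`
  set g : ℝ := η / D with hg_def
  have hgpos : 0 < g := div_pos hηpos hDpos
  have hg1 : g ≤ 1 := by
    rw [hg_def, div_le_one hDpos]; exact hη1.trans hD1
  set A : ℕ := ⌈Real.sqrt (32 * Cχ' / g)⌉₊ + 4 with hA_def
  have hA4 : 4 ≤ A := Nat.le_add_left 4 _
  have hA1 : (1 : ℝ) ≤ A := by exact_mod_cast (le_trans (by norm_num) hA4)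
  have hApos : (0 : ℝ) < A := by linarith
  have hAg : 32 * Cχ' ≤ g * (A : ℝ) ^ 2 := by
    have hs : Real.sqrt (32 * Cχ' / g) ≤ A := by
      calc Real.sqrt (32 * Cχ' / g) ≤ ⌈Real.sqrt (32 * Cχ' / g)⌉₊ := Nat.le_ceil _
        _ ≤ (A : ℝ) := by rw [hA_def]; push_cast; linarith
    have hsq : 32 * Cχ' / g ≤ (A : ℝ) ^ 2 := by
      calc 32 * Cχ' / g = Real.sqrt (32 * Cχ' / g) ^ 2 := (Real.sq_sqrt (by positivity)).symm
        _ ≤ (A : ℝ) ^ 2 := pow_le_pow_left₀ (Real.sqrt_nonneg _) hs 2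
    rw [div_le_iff₀ hgpos] at hsq
    linarith [mul_comm g ((A : ℝ) ^ 2)]
  -- the lower-bound constant `c₀ = g/(162 A²) ≤ e⁻¹` and `ℓB = log(1/c₀) ≥ 1`
  set c₀ : ℝ := g / (162 * (A : ℝ) ^ 2) with hc₀_def
  have hc₀pos : 0 < c₀ := by positivity
  have hc₀le : c₀ ≤ Real.exp (-1) := by
    have h1 : c₀ ≤ 1 / 162 := by
      rw [hc₀_def, div_le_div_iff₀ (by positivity) (by norm_num)]
      have hA2 : (1 : ℝ) ≤ (A : ℝ) ^ 2 := one_le_pow₀ hA1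
      have h162 : g * 162 ≤ 1 * 162 := by linarith
      have h162' : (1 : ℝ) * 162 ≤ 1 * (162 * (A : ℝ) ^ 2) := by linarith
      exact h162.trans h162'
    have he : Real.exp 1 < 3 := lt_trans Real.exp_one_lt_d9 (by norm_num)
    have h2 : (1 : ℝ) / 162 ≤ Real.exp (-1) := by
      rw [Real.exp_neg, one_div]
      exact inv_anti₀ (Real.exp_pos 1) (he.le.trans (by norm_num))
    exact h1.trans h2
  set ℓB : ℝ := -Real.log c₀ with hℓB_def
  have hℓB1 : 1 ≤ ℓB := by
    have := Real.log_le_log hc₀pos hc₀le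
    rw [Real.log_exp] at this
    linarith
  -- the `θ > η` constant
  set KB : ℝ := C₄ * r ^ 12 * (324 * Cχ') ^ 2 * (256 * D) ^ 2 / η ^ 2 with hKB_def
  have hKBpos : 0 < KB := by positivity
  -- thresholds
  set Λ₁ : ℝ := (KB / ε) ^ c₄⁻¹ with hΛ₁_def
  have hΛ₁ : 0 ≤ Λ₁ := Real.rpow_nonneg (by positivity) _
  set E : ℝ := Real.exp (Λ₁ + 1) with hE_def
  have hE1 : 1 < E := by rw [hE_def]; exact Real.one_lt_exp_iff.2 (by linarith)
  have hE0 : 0 < E := by linarith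
  set LB : ℝ := (A : ℝ) * (((4 + ℓB) * E) ^ 2 + 2) with hLB_def
  set Λc : ℝ := (C₄ * r ^ 12 / ε) ^ c₄⁻¹ with hΛc_def
  have hΛc : 0 ≤ Λc := Real.rpow_nonneg (by positivity) _
  set Lc : ℝ := Real.exp Λc + 1 with hLc_def
  set Ls : ℝ := 32 * 12 ^ 4 * r ^ 4 / ε + 2 with hLs_def
  refine ⟨max (max Ls Lc) (max LB 33), fun β L hβ hβc hL μ hμ => ?_⟩
  have hLs : Ls ≤ L := le_trans (le_trans (le_max_left _ _) (le_max_left _ _)) hL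
  have hLc : Lc ≤ L := le_trans (le_trans (le_max_right _ _) (le_max_left _ _)) hL
  have hLB : LB ≤ L := le_trans (le_trans (le_max_left _ _) (le_max_right _ _)) hL
  have hL33 : 33 ≤ L := le_trans (le_trans (le_max_right _ _) (le_max_right _ _)) hL
  have hL1 : 1 < L := by linarith
  have hL0 : 0 < L := by linarith
  have hL4 : 4 ≤ L := by linarith
  have hr0 : 0 < r := by linarith
  -- ### Regime 1: high temperature `β ≤ β₀`
  by_cases hββ₀ : β ≤ β₀
  · have h := ursellFourSum_le_of_le_smallBeta hU₁ hU₂ hF (by norm_num) hβ₀ hφ₀ hβ hββ₀ hβc hμ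
      (hTBdlr β hβ hβc μ hμ) (L := L) (r := r) (by linarith) hr
    refine h.trans ?_
    have hL4' : L ≤ L ^ 4 := le_self_pow₀ hL1.le (by norm_num)
    have hnum0 : (0 : ℝ) ≤ 32 * 12 ^ 4 * r ^ 4 := by positivity
    calc 32 * 12 ^ 4 * r ^ 4 / L ^ 4 ≤ 32 * 12 ^ 4 * r ^ 4 / L :=
          div_le_div_of_nonneg_left hnum0 hL0 hL4'
      _ ≤ ε := by
          rw [div_le_iff₀ hL0]
          have h1 : 32 * 12 ^ 4 * r ^ 4 / ε + 2 ≤ L := hLs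
          rw [div_add' _ _ _ hε.ne', div_le_iff₀ hε] at h1
          linarith [mul_comm L ε]
  push Not at hββ₀
  have hβpos : 0 < β := hβ₀.trans hββ₀
  -- ### Regime 2: `β = β_c`
  rcases hβc.lt_or_eq with hlt | heq
  swap
  · have h := H4 β L r hβ hβc (Or.inl heq) hL1 hr μ hμ
    refine h.trans ?_
    have hlogL : Λc ≤ Real.log L := by
      have h1 : Real.exp Λc ≤ L := by linarith
      rw [← Real.log_exp Λc]
      exact Real.log_le_log (Real.exp_pos _) h1
    have hlog0 : 0 < Real.log L := Real.log_pos hL1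
    have hlogc : 0 < Real.log L ^ c₄ := Real.rpow_pos_of_pos hlog0 c₄
    have hpow : C₄ * r ^ 12 / ε ≤ Real.log L ^ c₄ := by
      calc C₄ * r ^ 12 / ε = Λc ^ c₄ := by rw [hΛc_def, Real.rpow_inv_rpow (by positivity) hc₄.ne']
        _ ≤ Real.log L ^ c₄ := Real.rpow_le_rpow hΛc hlogL hc₄.le
    rw [div_le_iff₀ hlogc]
    rw [div_le_iff₀ hε] at hpow
    linarith [mul_comm ε (Real.log L ^ c₄)]
  -- ### `β₀ < β < β_c`: the state and its two-point function
  obtain ⟨hP, hS⟩ := isingGibbsMeasure_twoPoint_of_facts hU₁ hU₂ hF (by norm_num) hβ hβc hμ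
  haveI := hP
  set S : Site 4 → ℝ := twoPointFree 4 β with hSdef
  have hS0 : ∀ v, 0 ≤ S v := fun v => twoPointFree_nonneg hlim hgks hβ v
  have hS1 : ∀ v, S v ≤ 1 := fun v => twoPointFree_le_one hlim hβ v
  have hSz : S 0 = 1 := twoPointFree_zero 4 β
  have hS' : ∀ x y, ∫ σ, spinAt x σ * spinAt y σ ∂μ = S (x - y) := by
    intro x y
    rw [← hS y x]
    exact integral_congr_ae (ae_of_all _ fun σ => mul_comm _ _)
  have htp : ∀ u v, twoPoint μ spinAt u v = S (v - u) := fun u v => hS u v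
  have htp0 : twoPoint μ spinAt 0 = S := by
    funext v; rw [htp, sub_zero]
  -- infrared decay, summability, tree diagram bound
  have hIR : ∀ v : Site 4, (1 : ℝ) ≤ Site.supNorm v → S v ≤ A₀ / (Site.supNorm v : ℝ) ^ 2 := by
    intro v hv
    have hv0 : v ≠ 0 := by
      intro h; rw [h, Site.supNorm_eq_zero_iff.2 rfl] at hv; norm_num at hv
    have hnorm : (‖v‖ : ℝ) = Site.supNorm v := Site.norm_eq_supNorm v
    have hpos : (0 : ℝ) < Site.supNorm v := by linarith
    calc S v ≤ twoPointFree 4 (criticalBeta 4) v := twoPointFree_mono_beta hβmono hlim hβ hβc v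
      _ ≤ C₀ * (‖v‖ : ℝ) ^ (-(((4 : ℕ) : ℝ) - 2)) := hC₀ v hv0
      _ = C₀ / (Site.supNorm v : ℝ) ^ 2 := by
          rw [hnorm, show (-(((4 : ℕ) : ℝ) - 2)) = -(2 : ℝ) by norm_num, Real.rpow_neg hpos.le,
            Real.rpow_two, div_eq_mul_inv]
      _ ≤ A₀ / (Site.supNorm v : ℝ) ^ 2 := by
          gcongr; exact le_max_left _ _
  have h4 : Summable (fun v => S v ^ 4) :=
    summable_pow_four_of_decay hS0 hS1 (R := 2) (by norm_num) (fun v hv => hIR v (by linarith))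
  have hsumx := summable_prod_shift hS0 h4
  have hTB : ∀ x : Fin 4 → Site 4, |connectedFour μ spinAt x| ≤ 2 * ∑' u, ∏ i, S (x i - u) := by
    intro x
    have h := hTBdlr β hβ hβc μ hμ x
    simp_rw [hS'] at h
    exact h (hsumx x)
  -- susceptibility bounds: infrared, sliding-scale (constant `D`), MMS
  have hχS : ∀ t : ℝ, 1 ≤ t → boxSusceptibility S t ≤ Cχ' * t ^ 2 := fun t ht =>
    boxSusceptibility_le_sq_of_nat hCχ0.le (hCχ β hβ hβc) ht
  have h56' : ∀ ℓ' L' : ℝ, 1 ≤ ℓ' → ℓ' ≤ L' →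
      boxSusceptibility S L' / L' ^ 2 ≤ D * (boxSusceptibility S ℓ' / ℓ' ^ 2) := by
    intro ℓ' L' h1 h2
    have h := H56 β ℓ' L' hβpos hβc h1 h2 μ hμ
    rw [htp0] at h
    refine h.trans (mul_le_mul_of_nonneg_right ?_
      (div_nonneg (boxSusceptibility_nonneg hS0 _) (sq_nonneg _)))
    calc C₃ / β ≤ C₃ / β₀ := div_le_div_of_nonneg_left hC₃.le hβ₀ hββ₀.le
      _ ≤ D := le_max_left _ _
  have hMMS : ∀ z w : Site 4, 4 * Site.supNorm w ≤ Site.supNorm z → S z ≤ S w :=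
    fun z w h => twoPointFree_le_of_mul_supNorm_le hβ (by norm_num) h
  -- ### the dichotomy on `θ = χ_L/L²`
  by_cases hθη : boxSusceptibility S L / L ^ 2 ≤ η
  · -- `θ ≤ η`: the plain tree diagram bound suffices
    have h := ursellFourSum_le_sq_ratio hS hS0 hSz hMMS hDpos h56' h4 hTB hL4 hr
    have hθ0 : 0 ≤ boxSusceptibility S L / L ^ 2 :=
      div_nonneg (boxSusceptibility_nonneg hS0 _) (sq_nonneg _)
    calc ursellFourSum μ L r
        ≤ (2 * 256 ^ 2 * (48 ^ 4 * 289 ^ 4 + 54 * 81 ^ 4 * 4096)) * D ^ 6 * r ^ 12 *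
            (boxSusceptibility S L / L ^ 2) ^ 2 := h
      _ = KA * (boxSusceptibility S L / L ^ 2) ^ 2 := by rw [hKA_def, hK_def]
      _ ≤ KA * η ^ 2 := by gcongr
      _ ≤ KA * η := mul_le_mul_of_nonneg_left (by
          calc η ^ 2 = η * η := sq η
            _ ≤ η * 1 := mul_le_mul_of_nonneg_left hη1 hηpos.le
            _ = η := mul_one η) hKApos.le
      _ ≤ ε := hηε
  -- `θ > η`: the window scale
  push Not at hθη
  -- growth of `χ` on all scales below `L`
  have hgrow : ∀ ℓ : ℝ, 1 ≤ ℓ → ℓ ≤ L → g * ℓ ^ 2 ≤ boxSusceptibility S ℓ := by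
    intro ℓ hℓ1 hℓL
    have h := h56' ℓ L hℓ1 hℓL
    have hℓ0 : 0 < ℓ := by linarith
    have h' : η / D ≤ boxSusceptibility S ℓ / ℓ ^ 2 := by
      rw [div_le_iff₀ hDpos]
      linarith [mul_comm D (boxSusceptibility S ℓ / ℓ ^ 2)]
    rw [hg_def]
    rw [le_div_iff₀ (by positivity)] at h'
    exact h'
  -- the scale `n = ⌊L/A⌋`
  set n : ℕ := ⌊L / A⌋₊ with hn_def
  have hLoverA : ((4 + ℓB) * E) ^ 2 + 2 ≤ L / A := by
    rw [le_div_iff₀ hApos]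
    calc (((4 + ℓB) * E) ^ 2 + 2) * A = (A : ℝ) * (((4 + ℓB) * E) ^ 2 + 2) := by ring
      _ ≤ L := hLB
  have hn_ge : ((4 + ℓB) * E) ^ 2 + 1 ≤ (n : ℝ) := by
    have := Nat.lt_floor_add_one (L / A)
    linarith
  have hsqE : 0 ≤ ((4 + ℓB) * E) ^ 2 := sq_nonneg _
  have hn1r : (1 : ℝ) ≤ n := by linarith
  have hn1 : 1 ≤ n := by exact_mod_cast hn1r
  have hn0 : (0 : ℝ) < n := by linarith
  have hnle : (n : ℝ) ≤ L / A := Nat.floor_le (by positivity)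
  have hAnL : (A : ℝ) * n ≤ L := by
    have := mul_le_mul_of_nonneg_left hnle hApos.le
    rwa [mul_div_cancel₀ _ hApos.ne'] at this
  have hnL : (n : ℝ) ≤ L := le_trans (le_mul_of_one_le_left hn0.le hA1) hAnL
  have hAn1 : (1 : ℝ) ≤ (A : ℝ) * n := one_le_mul_of_one_le_of_one_le hA1 hn1r
  -- pointwise lower bound on the axis
  have hbig : g * ((A : ℝ) * n) ^ 2 ≤ boxSusceptibility S ((A : ℝ) * n) := hgrow _ hAn1 hAnL
  have hsmall : boxSusceptibility S ((4 : ℝ) * n) ≤ Cχ' * ((4 : ℝ) * n) ^ 2 := hχS _ (by linarith)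
  have haxis : c₀ / (n : ℝ) ^ 2 ≤ S (Pi.single 0 (n : ℤ)) := by
    have h := axis_twoPointFn_ge_of_growth hS0 hMMS hn1 hA4 hbig hsmall hAg
    calc c₀ / (n : ℝ) ^ 2 = g / (162 * (A : ℝ) ^ 2 * (n : ℝ) ^ 2) := by
          rw [hc₀_def, div_div]
      _ ≤ _ := h
  have hSnpos : 0 < S (Pi.single 0 (n : ℤ)) := lt_of_lt_of_le (by positivity) haxis
  -- the inverse correlation length: `ξ⁻¹ ≤ Q/n`, `Q = 2 log n + ℓB`
  have hplus : twoPointPlus 4 β = S := by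
    rw [← twoPoint_eq_twoPointPlus_of_isingGibbsMeasure hβ hβc hμ, htp0]
  set Q : ℝ := 2 * Real.log n + ℓB with hQ_def
  have hlogn0 : 0 ≤ Real.log n := Real.log_nonneg hn1r
  have hQ1 : 1 ≤ Q := by linarith
  have hQpos : 0 < Q := by linarith
  have hinv : invCorrLength (twoPointPlus 4 β) ≤ Q / n := by
    have hGn : twoPointPlus 4 β (Pi.single 0 (n : ℤ)) = S (Pi.single 0 (n : ℤ)) := by rw [hplus]
    have h := invCorrLength_twoPointPlus_le_axis (d := 4) hβ hn1 (by rw [hGn]; exact hSnpos)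
    refine h.trans ?_
    rw [hGn, div_le_div_iff_of_pos_right hn0]
    have h1 : Real.log (c₀ / (n : ℝ) ^ 2) ≤ Real.log (S (Pi.single 0 (n : ℤ))) :=
      Real.log_le_log (by positivity) haxis
    rw [Real.log_div hc₀pos.ne' (by positivity), Real.log_pow] at h1
    rw [hQ_def, hℓB_def]
    push_cast at h1
    linarith
  -- the window scale `L' = n/Q ≥ √n/(4 + ℓB) ≥ E`
  set L' : ℝ := (n : ℝ) / Q with hL'_def
  have hL'pos : 0 < L' := div_pos hn0 hQpos
  have hL'n : L' ≤ n := div_le_self hn0.le hQ1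
  have hL'L : L' ≤ L := hL'n.trans hnL
  have hlogn : Real.log n ≤ 2 * Real.sqrt n := by
    have h1 : Real.log (Real.sqrt n) ≤ Real.sqrt n - 1 :=
      Real.log_le_sub_one_of_pos (Real.sqrt_pos.2 hn0)
    rw [Real.log_sqrt hn0.le] at h1
    linarith [Real.sqrt_nonneg (n : ℝ)]
  have hsqrt1 : 1 ≤ Real.sqrt n := by
    rw [show (1 : ℝ) = Real.sqrt 1 from Real.sqrt_one.symm]
    exact Real.sqrt_le_sqrt hn1r
  have hQle : Q ≤ (4 + ℓB) * Real.sqrt n := by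
    have hℓ : ℓB * 1 ≤ ℓB * Real.sqrt n := mul_le_mul_of_nonneg_left hsqrt1 (by linarith)
    rw [hQ_def]
    linarith
  have hL'ge : Real.sqrt n / (4 + ℓB) ≤ L' := by
    rw [hL'_def, div_le_div_iff₀ (by positivity) hQpos]
    calc Real.sqrt n * Q ≤ Real.sqrt n * ((4 + ℓB) * Real.sqrt n) :=
          mul_le_mul_of_nonneg_left hQle (Real.sqrt_nonneg _)
      _ = (n : ℝ) * (4 + ℓB) := by
          rw [mul_comm (4 + ℓB), ← mul_assoc, Real.mul_self_sqrt hn0.le]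
  have hEL' : E ≤ L' := by
    have hsq : ((4 + ℓB) * E) ^ 2 ≤ (n : ℝ) := by linarith
    have h1 : (4 + ℓB) * E ≤ Real.sqrt n := by
      rw [show (4 + ℓB) * E = Real.sqrt (((4 + ℓB) * E) ^ 2) from
        (Real.sqrt_sq (by positivity)).symm]
      exact Real.sqrt_le_sqrt hsq
    calc E = (4 + ℓB) * E / (4 + ℓB) := by field_simp
      _ ≤ Real.sqrt n / (4 + ℓB) := div_le_div_of_nonneg_right h1 (by positivity)
      _ ≤ L' := hL'ge
  have hL'1 : 1 < L' := hE1.trans_le hEL'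
  have hlogL' : Λ₁ + 1 ≤ Real.log L' := by
    rw [← Real.log_exp (Λ₁ + 1)]
    exact Real.log_le_log (Real.exp_pos _) hEL'
  -- the radius parameter `r' = rL/L'`
  set r' : ℝ := r * L / L' with hr'_def
  have hr'L' : r' * L' = r * L := by rw [hr'_def]; field_simp
  have hr'1 : 1 ≤ r' := by
    rw [hr'_def, le_div_iff₀ hL'pos, one_mul]
    exact hL'L.trans (le_mul_of_one_le_left hL0.le hr)
  have hr'0 : 0 ≤ r' := by linarith
  -- the window hypothesis and the ADC bound at scale `L'`
  have hwin : L' * invCorrLength (twoPointPlus 4 β) ≤ 1 := by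
    calc L' * invCorrLength (twoPointPlus 4 β) ≤ L' * (Q / n) :=
          mul_le_mul_of_nonneg_left hinv hL'pos.le
      _ = 1 := by rw [hL'_def]; field_simp
  have hADC := H4 β L' r' hβ hβc (Or.inr ⟨hβpos, hwin⟩) hL'1 hr'1 μ hμ
  have hG : ∀ x y, 0 ≤ ∫ σ, spinAt x σ * spinAt y σ ∂μ := fun x y => by rw [hS]; exact hS0 _
  have hSig'pos : 0 < blockSpinVariance μ L' :=
    lt_of_lt_of_le one_pos (one_le_blockSpinVariance μ hG hL'pos.le)
  have hlogL'pos : 0 < Real.log L' := Real.log_pos hL'1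
  have hlogc : 0 < Real.log L' ^ c₄ := Real.rpow_pos_of_pos hlogL'pos c₄
  set M : ℝ := C₄ * r' ^ 12 / Real.log L' ^ c₄ with hM_def
  have hM0 : 0 ≤ M := by positivity
  have hnum : ∑ x ∈ Fintype.piFinset (fun _ : Fin 4 => latticeBox 4 (r * L)),
      |connectedFour μ spinAt x| ≤ M * blockSpinVariance μ L' ^ 2 := by
    have h := hADC
    rw [ursellFourSum, hr'L', div_le_iff₀ (pow_pos hSig'pos 2)] at h
    exact h
  have hχL : η * L ^ 2 ≤ boxSusceptibility S L := by
    have h := hθη.le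
    rwa [le_div_iff₀ (by positivity)] at h
  have hden := pow_four_mul_boxSusceptibility_le_blockSpinVariance μ hS hS0 hDpos.le h56' hL4
  have htransfer := ursellFourSum_le_of_window_transfer hS hS0 hχS hDpos hηpos hL1.le
    hL'1.le hM0 hnum hχL hden
  -- `M (324 C_χ)² (256 D)² L'¹² / (η² L¹²) = KB / (log L')^{c₄}` since `r' L' = r L`
  have hval : M * (324 * Cχ') ^ 2 * (256 * D) ^ 2 * L' ^ 12 / (η ^ 2 * L ^ 12) =
      KB / Real.log L' ^ c₄ := by
    rw [hM_def, hKB_def, hr'_def]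
    have hlc : Real.log L' ^ c₄ ≠ 0 := hlogc.ne'
    have hL'ne : L' ≠ 0 := hL'pos.ne'
    have hηne : η ≠ 0 := hηpos.ne'
    field_simp
  rw [hval] at htransfer
  refine htransfer.trans ?_
  have hpow : KB / ε ≤ Real.log L' ^ c₄ := by
    calc KB / ε = Λ₁ ^ c₄ := by rw [hΛ₁_def, Real.rpow_inv_rpow (by positivity) hc₄.ne']
      _ ≤ Real.log L' ^ c₄ := Real.rpow_le_rpow hΛ₁ (by linarith) hc₄.le
  rw [div_le_iff₀ hlogc]
  rw [div_le_iff₀ hε] at hpow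
  linarith [mul_comm ε (Real.log L' ^ c₄)]

/-- **Uniform smallness of `S(μ; L, r)` for every `d ≥ 4` from the correlation-length window
bound** (the hypothesis shape `hU` of `HighDimTrivialityAssembly`): `d = 4` by
`ursellFourSum_small_four_of_adc`, `d ≥ 5` by the tree's theorem
`ursellFourSum_uniformlySmall_of_five_le`. [cite: AizenmanDuminilCopinAnnals2021, arXiv:1912.07973 §6.3 and Def. 1.1] [cite: Panis2023Triviality, Thm. 5.5 and §1.2.1 fn. 2] -/
theorem ursellFourSum_uniformlySmall_of_adc (hS₄ : aizenmanDuminilCopin_ursellFourSum_le) :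
    ∀ {d : ℕ}, 4 ≤ d → ∀ r : ℝ, 1 ≤ r → ∀ ε : ℝ, 0 < ε → ∃ L₀ : ℝ,
      ∀ (β L : ℝ), 0 ≤ β → β ≤ criticalBeta d → L₀ ≤ L →
      ∀ μ ∈ isingGibbsMeasures d β 0, ursellFourSum μ L r ≤ ε := by
  intro d hd r hr ε hε
  rcases hd.eq_or_lt with h4 | hlt
  · subst h4
    exact ursellFourSum_small_four_of_adc hS₄ hr hε
  · exact ursellFourSum_uniformlySmall_of_five_le hlt hr hε

end Synthesis

/-! ### Part 4. crit-ising.S13 (`Sweep1` form) from ADC Theorem 1.3 -/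

universe u in
/-- **crit-ising.S13 in its original (`Sweep1`) form from the correlation-length window bound.**
The statement `isGaussianProcess_of_tendstoInDistribution_smearedSpin` (Aizenman–Duminil-Copin 2021,
Thm 1.2 with Def. 1.1, `d = 4`; Aizenman 1982 / Fröhlich 1982, `d ≥ 5`; arbitrary `β_k ∈ [0, β_c]`)
follows from the single named fact `aizenmanDuminilCopin_ursellFourSum_le` (ADC 2021, §6.3:
`Σ_L⁻² ∑_{Λ_{rL}⁴} |U₄| ≤ C r¹² (log L)^{-c}` for `d = 4`, `1 < L ≤ ξ(β)` or `β = β_c`): the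
exponential-moment bound is `abs_mgf_normalizedField_sub_exp_le_dlr`, the variance bounds are
`normalizedField_variance_bounds_holds`, the uniform smallness is
`ursellFourSum_uniformlySmall_of_adc`, and the probabilistic assembly is
`isGaussianProcess_of_tendstoInDistribution_smearedSpin_of_mgfBound`. Compare
`isGaussianProcess_of_tendstoInDistribution_smearedSpin_of_panis_four` (the same statement from the
sharp-length window bound of Panis 2023, Cor. 1.8). [cite: AizenmanDuminilCopinAnnals2021, arXiv:1912.07973 Thm 1.2 with Def. 1.1 (p. 4), Prop. 1.4 and §6.3 (pp. 6, 26–27)] -/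
theorem isGaussianProcess_of_tendstoInDistribution_smearedSpin_of_adc
    (hS₄ : aizenmanDuminilCopin_ursellFourSum_le) :
    isGaussianProcess_of_tendstoInDistribution_smearedSpin.{u} :=
  isGaussianProcess_of_tendstoInDistribution_smearedSpin_of_mgfBound
    (fun {_} hd {_ _ _} hβ hβc hL _ {_} hμ {_} hf hfr z =>
      abs_mgf_normalizedField_sub_exp_le_dlr (by omega) hβ hβc hL hμ hf hfr z)
    normalizedField_variance_bounds_holds (ursellFourSum_uniformlySmall_of_adc hS₄)

universe u in
/-- **crit-ising.S13 (`Sweep1` form) from Aizenman–Duminil-Copin 2021, Theorem 1.3 alone.** The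
improved tree diagram bound `aizenmanDuminilCopin_improvedTreeDiagramBound` (ADC 2021, Thm 1.3:
`|U₄(x,y,z,t)| ≤ C B_L(β)^{-c} ∑_u ∏⟨σ_uσ_·⟩` for `d = 4`, `β ≤ β_c`, `L ≤ ξ(β)` and points at mutual
distance `≥ L`) is the only named fact left in the trust base of the `Sweep1` statement: the
summation of §6.3 is `aizenmanDuminilCopin_ursellFourSum_le_of_facts` (`ImprovedTreeDiagramBoundSum`)
with the sliding-scale infrared bound, Thm 5.6, PROVED
(`aizenmanDuminilCopin_slidingScaleInfraredBound_holds`), and the rest is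
`isGaussianProcess_of_tendstoInDistribution_smearedSpin_of_adc`. The discharge
`isGaussianProcess_of_tendstoInDistribution_smearedSpin_holds` is this theorem applied to
`aizenmanDuminilCopin_improvedTreeDiagramBound_holds` once Theorem 1.3 is proved. [cite: AizenmanDuminilCopinAnnals2021, arXiv:1912.07973 Thm 1.3 (p. 6), Thm 5.6 (p. 18), §6.3 (pp. 26–27)] -/
theorem isGaussianProcess_of_tendstoInDistribution_smearedSpin_of_improvedTreeDiagramBound
    (h13 : aizenmanDuminilCopin_improvedTreeDiagramBound) :
    isGaussianProcess_of_tendstoInDistribution_smearedSpin.{u} :=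
  isGaussianProcess_of_tendstoInDistribution_smearedSpin_of_adc
    (aizenmanDuminilCopin_ursellFourSum_le_of_facts h13
      aizenmanDuminilCopin_slidingScaleInfraredBound_holds)


end Literature.Probability.LatticeModels
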